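import Literature.AlgebraicGeometry.DuqueFrancoVillaflor2025.JoinHilbertFunctionIdeal
import Literature.AlgebraicGeometry.HodgeTheory.CompleteIntersectionBezout
import HarnessLib

/-!
# The length of a join: `dim_K R^f ⊗ R^g = dim_K R^f · dim_K R^g` and the Sebastiani–Thom multiplicativity of
# the Milnor number, `μ(f ⊕ g) = μ(f)·μ(g)`

J. Duque Franco, R. Villaflor Loyola, *Periods of join algebraic cycles*, Ann. Sc. Norm. Super. Pisa (2025) =
arXiv:2312.17222, proof of Thm. 1.1 (p. 11): "Since `R^{f+g} = R^f ⊗ R^g` … Since `R^{f+g}` is Artinian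
Gorenstein of socle in degree `(d−2)(n+2)`" (disjoint sets of variables `x`, `y`; `R^f = ℂ[x]/J^f`), and
**Cor. 6.1** (the Hilbert function of the join is the convolution of the Hilbert functions).
[cite: DuqueFrancoVillaflor2025Join, Thm. 1.1 (proof, p. 11), Cor. 6.1]

A. Dimca, *Singularities and Topology of Hypersurfaces* (Universitext 1992), Ch. 3, **(3.21) Corollary
(Sebastiani–Thom)** and **(3.22) Theorem (Gabrielov) (i)**: for isolated hypersurface singularities `f`, `g`
in disjoint variables, with distinguished bases `Δ_1, …, Δ_{μ(f)}` and `Δ'_1, …, Δ'_{μ(g)}` of the vanishing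
homology, "the cycles `Δ_{ij} = θ̄(Δ_i ⊗ Δ'_j)` form a distinguished basis in `H_{n+m+1}(F_{f+g})`" — so that
`μ(f + g) = μ(f)·μ(g)`; and Ch. 1 (2.6) `μ(f) = dim 𝒪_n/J_f`, Remark (2.15)(ii) `μ = (d−1)^n` for a homogeneous
`f` of degree `d` in `n` variables. [cite: Dimca1992, Ch. 3 (3.21), (3.22)(i)]

**What this file proves (0 facts, 0 sorry)**, over any field `K`, in the language of the tree files
`DuqueFrancoVillaflor2025/JoinArtinianGorenstein.lean`, `JoinHilbertFunctionIdeal.lean` (the join ideal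
`I₁·S + I₂·S ⊆ S = K[x ⊔ y]` of ideals `I₁ ⊆ K[x]`, `I₂ ⊆ K[y]`, variables `Sum.inl` / `Sum.inr`) and
`HodgeTheory/CompleteIntersectionBezout.lean` (`dim_K S/I = Σ_t h_I(t)`, `dim_K S/J^F = (d−1)^{N+1}`):

* `IsArtinianGorenstein.finrank_quotient_eq_sum` — for an Artinian Gorenstein ideal of socle degree `σ₁`,
  `dim_K S/I = Σ_{t ≤ σ₁} h_I(t)`;
* **`IsArtinianGorenstein.finrank_quotient_join`** — `dim_K K[x ⊔ y]/(I₁S + I₂S) = dim_K K[x]/I₁ · dim_K K[y]/I₂`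
  for Artinian Gorenstein `I₁`, `I₂` ("`R^{f+g} = R^f ⊗ R^g`" numerically; via Cor. 6.1,
  tree `IsArtinianGorenstein.hilbert_join`, summed over all degrees: `sum_range_conv_eq_mul`);
* `span_pderiv_sebastianiThom` — the Jacobian ideal of `f(x) + g(y)` is the join of the Jacobian ideals:
  `(∂(f ⊕ g)/∂z_i : i) = J^f·S + J^g·S`;
* **`finrank_quotient_jacobian_sebastianiThom`** — **`μ(f ⊕ g) = μ(f)·μ(g) = (d−1)^{a+1}(e−1)^{b+1}`**: for forms
  `f` of degree `d ≥ 2` in `a + 1` variables and `g` of degree `e ≥ 2` in `b + 1` other variables, both with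
  finite-dimensional Jacobian rings, the Jacobian ring of `f(x) + g(y)` has dimension `(d−1)^{a+1}·(e−1)^{b+1}`
  (no relation between `d` and `e` is needed).

HONEST FRAMING (cell pub-hlocus): certified instances and evidence bearing on the general Hodge conjecture;
no claim.

## References

* [DuqueFrancoVillaflor2025Join] J. Duque Franco, R. Villaflor Loyola, *Periods of join algebraic cycles*,
  arXiv:2312.17222, Thm. 1.1 (proof, p. 11), Cor. 6.1.
* [Dimca1992] A. Dimca, *Singularities and Topology of Hypersurfaces*, Universitext, Springer 1992, Ch. 1
  (2.6), (2.15); Ch. 3 (3.21), (3.22).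
-/

noncomputable section

open MvPolynomial Module Finset
open Literature.RingTheory.MvPolynomial Literature.AlgebraicGeometry.HodgeTheory

attribute [local instance] MvPolynomial.gradedAlgebra

namespace Literature.AlgebraicGeometry.DuqueFrancoVillaflor2025

universe u

variable {K : Type u} [Field K]

/-! ### Summing a convolution over all degrees -/

/-- `Σ_{k ≤ A+B} (f * g)(k) = (Σ_{p ≤ A} f(p)) · (Σ_{q ≤ B} g(q))` for functions vanishing above `A` resp. `B`
(the total dimension of a tensor product of graded vector spaces concentrated in degrees `≤ A`, `≤ B`).
[folklore] -/
private theorem sum_range_conv_eq_mul (f g : ℕ → ℕ) {A B : ℕ} (hf : ∀ p, A < p → f p = 0)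
    (hg : ∀ q, B < q → g q = 0) :
    ∑ k ∈ range (A + B + 1), conv f g k = (∑ p ∈ range (A + 1), f p) * ∑ q ∈ range (B + 1), g q := by
  simp_rw [conv_eq_sum_range]
  rw [sum_range_diag_flip (A + B + 1) (fun p q => f p * g q)]
  -- extend the inner ranges to `range (A + B + 1)`: the extra terms vanish
  have hinner : ∀ p ∈ range (A + B + 1),
      ∑ q ∈ range (A + B + 1 - p), f p * g q = ∑ q ∈ range (A + B + 1), f p * g q := by
    intro p _
    refine sum_subset (range_subset_range.mpr (by omega)) fun q hq hq' => ?_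
    rw [mem_range] at hq hq'
    by_cases hp : A < p
    · rw [hf p hp, zero_mul]
    · rw [hg q (by omega), mul_zero]
  rw [sum_congr rfl hinner, ← sum_mul_sum]
  -- shrink the outer ranges back: the extra terms vanish
  have h1 : ∑ p ∈ range (A + B + 1), f p = ∑ p ∈ range (A + 1), f p := by
    symm
    refine sum_subset (range_subset_range.mpr (by omega)) fun p hp hp' => ?_
    rw [mem_range] at hp hp'
    exact hf p (by omega)
  have h2 : ∑ q ∈ range (A + B + 1), g q = ∑ q ∈ range (B + 1), g q := by
    symm
    refine sum_subset (range_subset_range.mpr (by omega)) fun q hq hq' => ?_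
    rw [mem_range] at hq hq'
    exact hg q (by omega)
  rw [h1, h2]

/-! ### The length of an Artinian Gorenstein quotient and of a join -/

section Join

variable {σ τ : Type*} [Finite σ] [Finite τ]

/-- **`dim_K S/I = Σ_{t ≤ σ₁} h_I(t)`** for an Artinian Gorenstein ideal `I` of socle degree `σ₁` (`R_e = 0` for
`e > σ₁`, Def. 2.1 (i)). [cite: DuqueFrancoVillaflor2025Join, Definition 2.1 (i)] -/
theorem IsArtinianGorenstein.finrank_quotient_eq_sum {I : Ideal (MvPolynomial σ K)} {σ₁ : ℕ}
    (h : IsArtinianGorenstein I σ₁) :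
    finrank K (MvPolynomial σ K ⧸ I) =
      ∑ t ∈ range (σ₁ + 1), (finrank K (homogeneousSubmodule σ K t) - finrank K (idealDegree I t)) := by
  refine finrank_quotient_eq_sum_hilbert h.isHomogeneous fun t ht p hp => ?_
  rw [← h.idealDegree_eq_of_lt ht] at hp
  exact (mem_idealDegree.mp hp).1

/-- The Hilbert function of an Artinian Gorenstein ideal vanishes above the socle degree.
[cite: DuqueFrancoVillaflor2025Join, Definition 2.1 (i)] -/
theorem IsArtinianGorenstein.hilbert_eq_zero_of_lt {I : Ideal (MvPolynomial σ K)} {σ₁ : ℕ}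
    (h : IsArtinianGorenstein I σ₁) {t : ℕ} (ht : σ₁ < t) :
    finrank K (homogeneousSubmodule σ K t) - finrank K (idealDegree I t) = 0 := by
  rw [h.idealDegree_eq_of_lt ht, Nat.sub_self]

/-- **`dim_K R₁ ⊗ R₂ = dim_K R₁ · dim_K R₂` for the join** ("`R^{f+g} = R^f ⊗ R^g`", numerically): for Artinian
Gorenstein ideals `I₁ ⊆ K[x]`, `I₂ ⊆ K[y]`,
`dim_K K[x ⊔ y]/(I₁·S + I₂·S) = dim_K K[x]/I₁ · dim_K K[y]/I₂` — the convolution formula for the Hilbert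
function of the join (Cor. 6.1) summed over all degrees.
[cite: DuqueFrancoVillaflor2025Join, Thm. 1.1 (proof, p. 11), Cor. 6.1] -/
theorem IsArtinianGorenstein.finrank_quotient_join {I₁ : Ideal (MvPolynomial σ K)}
    {I₂ : Ideal (MvPolynomial τ K)} {σ₁ σ₂ : ℕ} (h₁ : IsArtinianGorenstein I₁ σ₁)
    (h₂ : IsArtinianGorenstein I₂ σ₂) :
    finrank K (MvPolynomial (σ ⊕ τ) K ⧸
        (I₁.map (rename Sum.inl) ⊔ I₂.map (rename Sum.inr) : Ideal (MvPolynomial (σ ⊕ τ) K))) =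
      finrank K (MvPolynomial σ K ⧸ I₁) * finrank K (MvPolynomial τ K ⧸ I₂) := by
  rw [(isArtinianGorenstein_join h₁ h₂).finrank_quotient_eq_sum, h₁.finrank_quotient_eq_sum,
    h₂.finrank_quotient_eq_sum, sum_congr rfl fun k _ => h₁.hilbert_join h₂ k]
  exact sum_range_conv_eq_mul _ _ (fun p hp => h₁.hilbert_eq_zero_of_lt hp)
    (fun q hq => h₂.hilbert_eq_zero_of_lt hq)

end Join

/-! ### Sebastiani–Thom: `μ(f ⊕ g) = μ(f)·μ(g)` for homogeneous isolated singularities -/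

open Literature.AlgebraicGeometry.Motives.UniversalHypersurface

section SebastianiThom

variable {σ τ : Type*}

/-- **The Jacobian ideal of `f(x) + g(y)` is the join of the Jacobian ideals**:
`(∂(f ⊕ g)/∂z_i : i ∈ σ ⊔ τ) = (∂f/∂x_i)·S + (∂g/∂y_j)·S` in `S = K[x ⊔ y]` (disjoint sets of variables).
[cite: DuqueFrancoVillaflor2025Join, Thm. 1.1 (proof, p. 11)] -/
theorem span_pderiv_sebastianiThom (f : MvPolynomial σ K) (g : MvPolynomial τ K) :
    Ideal.span (Set.range fun i : σ ⊕ τ =>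
        pderiv i (rename Sum.inl f + rename Sum.inr g : MvPolynomial (σ ⊕ τ) K)) =
      (Ideal.span (Set.range fun i : σ => pderiv i f)).map (rename Sum.inl) ⊔
        (Ideal.span (Set.range fun j : τ => pderiv j g)).map
          (rename Sum.inr : MvPolynomial τ K →ₐ[K] MvPolynomial (σ ⊕ τ) K) := by
  classical
  -- the partials of `f(x) + g(y)`
  have hinl : ∀ i : σ, pderiv (Sum.inl i) (rename Sum.inl f + rename Sum.inr g : MvPolynomial (σ ⊕ τ) K) =
      rename Sum.inl (pderiv i f) := by
    intro i
    have hnot : Sum.inl i ∉ (rename Sum.inr g : MvPolynomial (σ ⊕ τ) K).vars := by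
      intro hmem
      obtain ⟨j, -, hj⟩ := Finset.mem_image.mp (vars_rename Sum.inr g hmem)
      exact Sum.inr_ne_inl hj
    rw [map_add, pderiv_rename Sum.inl_injective, pderiv_eq_zero_of_notMem_vars hnot, add_zero]
  have hinr : ∀ j : τ, pderiv (Sum.inr j) (rename Sum.inl f + rename Sum.inr g : MvPolynomial (σ ⊕ τ) K) =
      rename Sum.inr (pderiv j g) := by
    intro j
    have hnot : Sum.inr j ∉ (rename Sum.inl f : MvPolynomial (σ ⊕ τ) K).vars := by
      intro hmem
      obtain ⟨i, -, hi⟩ := Finset.mem_image.mp (vars_rename Sum.inl f hmem)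
      exact Sum.inl_ne_inr hi
    rw [map_add, pderiv_rename Sum.inr_injective, pderiv_eq_zero_of_notMem_vars hnot, zero_add]
  rw [Ideal.map_span, Ideal.map_span, ← Ideal.span_union]
  congr 1
  ext p
  simp only [Set.mem_range, Set.mem_union, Set.mem_image]
  constructor
  · rintro ⟨i, rfl⟩
    cases i with
    | inl i => exact Or.inl ⟨pderiv i f, ⟨i, rfl⟩, (hinl i).symm⟩
    | inr j => exact Or.inr ⟨pderiv j g, ⟨j, rfl⟩, (hinr j).symm⟩
  · rintro (⟨_, ⟨i, rfl⟩, rfl⟩ | ⟨_, ⟨j, rfl⟩, rfl⟩)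
    · exact ⟨Sum.inl i, hinl i⟩
    · exact ⟨Sum.inr j, hinr j⟩

end SebastianiThom

/-- **Sebastiani–Thom for the Milnor number of homogeneous isolated singularities, `μ(f ⊕ g) = μ(f)·μ(g)`**: for
a form `f` of degree `d ≥ 2` in the variables `x_0, …, x_a` and a form `g` of degree `e ≥ 2` in other variables
`y_0, …, y_b`, both with finite-dimensional Jacobian ring, the Jacobian (Milnor) ring of `f(x) + g(y)` has
dimension `(d−1)^{a+1} · (e−1)^{b+1}` ("the cycles `Δ_{ij} = θ̄(Δ_i ⊗ Δ'_j)` form a distinguished basis in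
`H_{n+m+1}(F_{f+g})`", with `μ = (d−1)^n` for a homogeneous singularity).
[cite: Dimca1992, Ch. 3 (3.21), (3.22)(i); Ch. 1 (2.15)(ii)] [cite: DuqueFrancoVillaflor2025Join, Thm. 1.1
(proof, p. 11)] -/
theorem finrank_quotient_jacobian_sebastianiThom {a b d e : ℕ} {f : MvPolynomial (Fin (a + 1)) K}
    {g : MvPolynomial (Fin (b + 1)) K} (hf : f.IsHomogeneous d) (hd : 2 ≤ d) (hg : g.IsHomogeneous e)
    (he : 2 ≤ e) [Module.Finite K (MvPolynomial (Fin (a + 1)) K ⧸ jacobianIdeal f)]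
    [Module.Finite K (MvPolynomial (Fin (b + 1)) K ⧸ jacobianIdeal g)] :
    finrank K (MvPolynomial (Fin (a + 1) ⊕ Fin (b + 1)) K ⧸
        Ideal.span (Set.range fun i : Fin (a + 1) ⊕ Fin (b + 1) =>
          pderiv i (rename Sum.inl f + rename Sum.inr g : MvPolynomial (Fin (a + 1) ⊕ Fin (b + 1)) K))) =
      (d - 1) ^ (a + 1) * (e - 1) ^ (b + 1) := by
  rw [span_pderiv_sebastianiThom]
  have h1 := isArtinianGorenstein_jacobianIdeal_of_finite hf hd
  have h2 := isArtinianGorenstein_jacobianIdeal_of_finite hg he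
  have hj := h1.finrank_quotient_join h2
  rw [finrank_quotient_jacobianIdeal_eq_pow_of_finite hf hd, finrank_quotient_jacobianIdeal_eq_pow_of_finite hg he]
    at hj
  exact hj

end Literature.AlgebraicGeometry.DuqueFrancoVillaflor2025
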